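import Mathlib.Analysis.Calculus.MeanValue
import Mathlib.Analysis.SpecialFunctions.ExpDeriv
import Literature.Analysis.ODE.DiagonalKernelMaximum
import HarnessLib

/-!
# Quasi-monotone growth through a barrier from a slightly negative start (Riccati comparison)

Topic `Literature/Analysis/ODE` (namespace `Literature.Analysis.ODE`). The REAL equation `y″ = q(x) y`
on an interval `[b, T]` with `q ≥ 0` (a classically forbidden region) and a COMPLEX solution `u` that
never vanishes there (e.g. it carries a non-zero flux `Im(ū u′)`). The logarithmic rate
`η = Re(ū u′)/|u|²` obeys the Riccati inequality `η′ ≥ q − η²` (`(Re ūu′)² ≤ |u|²|u′|²`), equivalently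
`ζ := −η` obeys `ζ′ ≤ ζ² − q`. If `u` enters the region with `ζ(b) ≤ ε` (slightly INWARD-shrinking,
think: the horizon-normalised solution of Carter's equation leaving a thin oscillatory cap at a
frequency just off the superradiant threshold), then:

* `negRate_le_of_start` — `ζ ≤ 2ε` on `[b, s₁]` as long as `4ε(s₁ − b) ≤ 1` (comparison with the
  super-solution `ε/(1 − 2ε(x − b))` of `z′ = 2z²`);
* `negRate_le_of_floor` — if moreover `q ≥ k²` on `[s₁, T]` with `2ε < k`, then `ζ ≤ 2ε` on `[s₁, T]`
  too (at `ζ = 2ε`, `ζ′ ≤ 4ε² − k² < 0`);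
* `negRate_nonpos_of_subsolution` — if in addition a sub-solution `Q` with `Q′ ≤ q − 4ε²` on
  `[s₁, s₃] ⊆ [s₁, T]` gains `Q(s₃) − Q(s₁) ≥ 2ε`, then `ζ ≤ 0`, i.e. `Re(ū u′) ≥ 0`, on `[s₃, T]`
  (`ζ + Q` is non-increasing while `ζ > 0`; once `ζ ≤ 0` it stays so since `q > 0`);
* `norm_le_exp_mul_norm_of_negRate` — quasi-monotonicity: `|u(x)| ≤ e^{2ε(s₃ − b)}·|u(y)|` for
  `b ≤ x ≤ y ≤ T`, `s₃ ≤ y` (`(log|u|²)′ = −2ζ ≥ −4ε` on `[b, T]`, `≥ 0` on `[s₃, T]`).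

The fencing lemma is Mathlib's `image_le_of_deriv_right_lt_deriv_boundary'`. These are the
perturbed forms of `ForbiddenHalfLineGrowth` (which is the case `ε = 0`, `b = −∞`) used in the threshold
SLIVER `0 < |ω − mω₊| ≤ 2ξ₁κ` of the near-extremal Kerr programme (crux `KappaExplicitWaveDecay`).
All proved; hypotheses are pointwise `HasDerivAt` statements on `[b, T]`.

## References
* P. Hartman, *Ordinary Differential Equations* (SIAM Classics 38, 2002), Ch. XI §§2, 6 (Riccati
  equation of a disconjugate equation). Key `Hartman2002`.
-/

noncomputable section

open Set Filter Topology
open scoped ComplexConjugate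

namespace Literature.Analysis.ODE

section QuasiMonotone

variable {u u' : ℝ → ℂ} {q : ℝ → ℝ} {b T : ℝ}

/-! ### The Riccati inequality for `ζ = −Re(ū u′)/|u|²` -/

/-- **Derivative of the negative logarithmic rate.** For a solution of `y″ = q y` with `u(x) ≠ 0`:
`ζ = −Re(ū u′)/|u|²` has derivative `ζ′ = ζ² − q − D` at `x` with
`D = |u′|²/|u|² − ζ² ≥ 0` (`(Re ūu′)² ≤ |u|²|u′|²`). [cite: Hartman2002, Ch. XI §2] -/
theorem hasDerivAt_negRate (hu : ∀ x ∈ Icc b T, HasDerivAt u (u' x) x ∧ HasDerivAt u' ((q x : ℂ) * u x) x)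
    {x : ℝ} (hx : x ∈ Icc b T) (hne : u x ≠ 0) :
    HasDerivAt (fun y ↦ -(conj (u y) * u' y).re / ‖u y‖ ^ 2)
      ((-(conj (u x) * u' x).re / ‖u x‖ ^ 2) ^ 2 - q x -
        (‖u' x‖ ^ 2 / ‖u x‖ ^ 2 - (-(conj (u x) * u' x).re / ‖u x‖ ^ 2) ^ 2)) x ∧
    0 ≤ ‖u' x‖ ^ 2 / ‖u x‖ ^ 2 - (-(conj (u x) * u' x).re / ‖u x‖ ^ 2) ^ 2 := by
  have hf : HasDerivAt (fun y ↦ ‖u y‖ ^ 2) (2 * (conj (u x) * u' x).re) x :=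
    hasDerivAt_norm_sq_complex (hu x hx).1
  have hg : HasDerivAt (fun y ↦ 2 * (conj (u y) * u' y).re) (2 * ‖u' x‖ ^ 2 + 2 * q x * ‖u x‖ ^ 2) x :=
    hasDerivAt_two_re_conj_mul (hu x hx).1 (hu x hx).2
  have hg' : HasDerivAt (fun y ↦ -(conj (u y) * u' y).re) (-(‖u' x‖ ^ 2 + q x * ‖u x‖ ^ 2)) x := by
    have := hg.const_mul (-(1 / 2 : ℝ))
    refine (this.congr_of_eventuallyEq ?_).congr_deriv (by ring)
    exact Eventually.of_forall fun y ↦ by ring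
  have hpos : 0 < ‖u x‖ ^ 2 := by positivity
  have hne2 : ‖u x‖ ^ 2 ≠ 0 := hpos.ne'
  set f := ‖u x‖ ^ 2 with hfdef
  set g := (conj (u x) * u' x).re with hgdef
  -- Cauchy–Schwarz at the point
  have hCS : g ^ 2 ≤ f * ‖u' x‖ ^ 2 := by
    have h := re_sq_add_im_sq_conj_mul (u x) (u' x)
    rw [hgdef, hfdef]
    nlinarith [sq_nonneg (conj (u x) * u' x).im, h]
  constructor
  · have hd := hg'.div hf hne2
    refine hd.congr_deriv ?_
    rw [← hfdef, ← hgdef]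
    field_simp
    ring
  · rw [div_pow, neg_sq, sub_nonneg, div_le_div_iff₀ (by positivity) hpos]
    nlinarith [hCS, hpos]

/-! ### The three comparison steps -/

/-- **Start**: if `ζ(b) ≤ ε` (`ε > 0`) and `4ε(s₁ − b) ≤ 1`, then `ζ ≤ 2ε` on `[b, s₁]` (`s₁ ≤ T`).
[folklore] -/
theorem negRate_le_of_start (hu : ∀ x ∈ Icc b T, HasDerivAt u (u' x) x ∧ HasDerivAt u' ((q x : ℂ) * u x) x)
    (hne : ∀ x ∈ Icc b T, u x ≠ 0) (hq : ∀ x ∈ Icc b T, 0 ≤ q x) {ε s₁ : ℝ} (hε : 0 < ε)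
    (hs₁ : s₁ ∈ Icc b T) (hlen : 4 * ε * (s₁ - b) ≤ 1)
    (hstart : -(conj (u b) * u' b).re / ‖u b‖ ^ 2 ≤ ε) :
    ∀ x ∈ Icc b s₁, -(conj (u x) * u' x).re / ‖u x‖ ^ 2 ≤ 2 * ε := by
  set ζ : ℝ → ℝ := fun y ↦ -(conj (u y) * u' y).re / ‖u y‖ ^ 2 with hζ
  have hsub : Icc b s₁ ⊆ Icc b T := Icc_subset_Icc_right hs₁.2
  -- derivative data of `ζ` on `[b, s₁]`
  have hder : ∀ x ∈ Icc b s₁, HasDerivAt ζ (ζ x ^ 2 - q x -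
      (‖u' x‖ ^ 2 / ‖u x‖ ^ 2 - ζ x ^ 2)) x ∧ 0 ≤ ‖u' x‖ ^ 2 / ‖u x‖ ^ 2 - ζ x ^ 2 :=
    fun x hx ↦ hasDerivAt_negRate hu (hsub hx) (hne x (hsub hx))
  -- the super-solution `B = ε/(1 − 2ε(x − b))`
  set B : ℝ → ℝ := fun y ↦ ε / (1 - 2 * ε * (y - b)) with hB
  have hden : ∀ y ∈ Icc b s₁, 1 / 2 ≤ 1 - 2 * ε * (y - b) := by
    intro y hy
    have : 2 * ε * (y - b) ≤ 2 * ε * (s₁ - b) := by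
      apply mul_le_mul_of_nonneg_left (by linarith [hy.2]) (by positivity)
    linarith
  have hBder : ∀ y ∈ Icc b s₁, HasDerivAt B (2 * B y ^ 2) y := by
    intro y hy
    have hd0 : 1 - 2 * ε * (y - b) ≠ 0 := by linarith [hden y hy]
    have h1 : HasDerivAt (fun z ↦ 1 - 2 * ε * (z - b)) (-(2 * ε)) y := by
      have := (((hasDerivAt_id y).sub_const b).const_mul (2 * ε)).const_sub 1
      simpa using this
    have h2 := (hasDerivAt_const y ε).div h1 hd0
    refine h2.congr_deriv ?_
    simp only [hB]
    field_simp
    ring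
  have key := image_le_of_deriv_right_lt_deriv_boundary' (f := ζ) (a := b) (b := s₁)
    (f' := fun x ↦ ζ x ^ 2 - q x - (‖u' x‖ ^ 2 / ‖u x‖ ^ 2 - ζ x ^ 2))
    (fun x hx ↦ (hder x hx).1.continuousAt.continuousWithinAt)
    (fun x hx ↦ (hder x (Ico_subset_Icc_self hx)).1.hasDerivWithinAt)
    (B := B) (B' := fun y ↦ 2 * B y ^ 2)
    (by simp only [hB]; rw [sub_self, mul_zero, sub_zero, div_one]; exact hstart)
    (fun x hx ↦ (hBder x hx).continuousAt.continuousWithinAt)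
    (fun x hx ↦ (hBder x (Ico_subset_Icc_self hx)).hasDerivWithinAt)
    (fun x hx hxB ↦ by
      have hx' : x ∈ Icc b s₁ := Ico_subset_Icc_self hx
      have hD := (hder x hx').2
      have hBpos : 0 < B x := div_pos hε (by linarith [hden x hx'])
      have hq0 := hq x (hsub hx')
      show ζ x ^ 2 - q x - (‖u' x‖ ^ 2 / ‖u x‖ ^ 2 - ζ x ^ 2) < 2 * B x ^ 2
      rw [hxB]; nlinarith)
  intro x hx
  have h1 : ζ x ≤ B x := key hx
  have h2 : B x ≤ 2 * ε := by
    simp only [hB]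
    rw [div_le_iff₀ (by linarith [hden x hx])]
    nlinarith [hden x hx]
  exact h1.trans h2

/-- **Floor**: if `ζ(s₁) ≤ 2ε`, `q ≥ k²` on `[s₁, T]` and `2ε < k`, then `ζ ≤ 2ε` on `[s₁, T]`.
[folklore] -/
theorem negRate_le_of_floor (hu : ∀ x ∈ Icc b T, HasDerivAt u (u' x) x ∧ HasDerivAt u' ((q x : ℂ) * u x) x)
    (hne : ∀ x ∈ Icc b T, u x ≠ 0) {ε k s₁ : ℝ} (hε : 0 < ε) (hs₁ : s₁ ∈ Icc b T)
    (hk : 2 * ε < k) (hqk : ∀ x ∈ Icc s₁ T, k ^ 2 ≤ q x)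
    (hstart : -(conj (u s₁) * u' s₁).re / ‖u s₁‖ ^ 2 ≤ 2 * ε) :
    ∀ x ∈ Icc s₁ T, -(conj (u x) * u' x).re / ‖u x‖ ^ 2 ≤ 2 * ε := by
  set ζ : ℝ → ℝ := fun y ↦ -(conj (u y) * u' y).re / ‖u y‖ ^ 2 with hζ
  have hsub : Icc s₁ T ⊆ Icc b T := Icc_subset_Icc_left hs₁.1
  have hder : ∀ x ∈ Icc s₁ T, HasDerivAt ζ (ζ x ^ 2 - q x -
      (‖u' x‖ ^ 2 / ‖u x‖ ^ 2 - ζ x ^ 2)) x ∧ 0 ≤ ‖u' x‖ ^ 2 / ‖u x‖ ^ 2 - ζ x ^ 2 :=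
    fun x hx ↦ hasDerivAt_negRate hu (hsub hx) (hne x (hsub hx))
  have key := image_le_of_deriv_right_lt_deriv_boundary (f := ζ) (a := s₁) (b := T)
    (f' := fun x ↦ ζ x ^ 2 - q x - (‖u' x‖ ^ 2 / ‖u x‖ ^ 2 - ζ x ^ 2))
    (fun x hx ↦ (hder x hx).1.continuousAt.continuousWithinAt)
    (fun x hx ↦ (hder x (Ico_subset_Icc_self hx)).1.hasDerivWithinAt)
    (B := fun _ ↦ 2 * ε) (B' := fun _ ↦ 0) hstart (fun x ↦ hasDerivAt_const x _)
    (fun x hx hxB ↦ by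
      have hx' : x ∈ Icc s₁ T := Ico_subset_Icc_self hx
      have hD := (hder x hx').2
      have hq0 := hqk x hx'
      show ζ x ^ 2 - q x - (‖u' x‖ ^ 2 / ‖u x‖ ^ 2 - ζ x ^ 2) < 0
      have hζx : ζ x = 2 * ε := hxB
      rw [hζx]
      have : (2 * ε) ^ 2 < k ^ 2 := by nlinarith
      nlinarith)
  exact fun x hx ↦ key hx

/-- **Crossing to outward growth**: if `0 ≤ ζ… ` — precisely: `ζ ≤ 2ε` on `[s₁, T]`, `q ≥ k² > 0` on
`[s₁, T]`, and a sub-solution `Q` with `Q′ ≤ q − 4ε²` on `[s₁, s₃]` (`s₁ ≤ s₃ ≤ T`) gains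
`Q(s₃) − Q(s₁) ≥ 2ε`, then `ζ ≤ 0`, i.e. `0 ≤ Re(ū u′)`, on `[s₃, T]`. [folklore] -/
theorem negRate_nonpos_of_subsolution
    (hu : ∀ x ∈ Icc b T, HasDerivAt u (u' x) x ∧ HasDerivAt u' ((q x : ℂ) * u x) x)
    (hne : ∀ x ∈ Icc b T, u x ≠ 0) {ε k s₁ s₃ : ℝ} (hs₁ : b ≤ s₁) (hs₁₃ : s₁ ≤ s₃)
    (hs₃ : s₃ ≤ T) (hk : 0 < k) (hqk : ∀ x ∈ Icc s₁ T, k ^ 2 ≤ q x)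
    (hζ : ∀ x ∈ Icc s₁ T, -(conj (u x) * u' x).re / ‖u x‖ ^ 2 ≤ 2 * ε)
    {Q Q' : ℝ → ℝ} (hQ : ∀ x ∈ Icc s₁ s₃, HasDerivAt Q (Q' x) x)
    (hQ' : ∀ x ∈ Icc s₁ s₃, Q' x ≤ q x - 4 * ε ^ 2) (hgain : 2 * ε ≤ Q s₃ - Q s₁) :
    ∀ x ∈ Icc s₃ T, 0 ≤ (conj (u x) * u' x).re := by
  set ζ : ℝ → ℝ := fun y ↦ -(conj (u y) * u' y).re / ‖u y‖ ^ 2 with hζdef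
  have hsub : Icc s₁ T ⊆ Icc b T := Icc_subset_Icc_left hs₁
  have hsub₃ : Icc s₁ s₃ ⊆ Icc s₁ T := Icc_subset_Icc_right hs₃
  have hder : ∀ x ∈ Icc s₁ T, HasDerivAt ζ (ζ x ^ 2 - q x -
      (‖u' x‖ ^ 2 / ‖u x‖ ^ 2 - ζ x ^ 2)) x ∧ 0 ≤ ‖u' x‖ ^ 2 / ‖u x‖ ^ 2 - ζ x ^ 2 :=
    fun x hx ↦ hasDerivAt_negRate hu (hsub hx) (hne x (hsub hx))
  -- Step 1: some point `t ∈ [s₁, s₃]` has `ζ t ≤ 0`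
  have hexists : ∃ t ∈ Icc s₁ s₃, ζ t ≤ 0 := by
    by_contra hcon
    push Not at hcon
    -- `ζ + Q` is non-increasing on `[s₁, s₃]` (there `0 < ζ ≤ 2ε`)
    have hanti : AntitoneOn (ζ + Q) (Icc s₁ s₃) := by
      refine antitoneOn_of_deriv_nonpos (convex_Icc s₁ s₃)
        (fun y hy ↦ ((hder y (hsub₃ hy)).1.add (hQ y hy)).continuousAt.continuousWithinAt)
        (fun y hy ↦ ((hder y (hsub₃ (interior_subset hy))).1.add
          (hQ y (interior_subset hy))).differentiableAt.differentiableWithinAt) ?_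
      intro y hy
      have hy' : y ∈ Icc s₁ s₃ := interior_subset hy
      rw [((hder y (hsub₃ hy')).1.add (hQ y hy')).deriv]
      have h1 := (hder y (hsub₃ hy')).2
      have h2 := hQ' y hy'
      have h3 : 0 < ζ y := hcon y hy'
      have h4 : ζ y ≤ 2 * ε := hζ y (hsub₃ hy')
      have h5 : ζ y ^ 2 ≤ (2 * ε) ^ 2 := pow_le_pow_left₀ h3.le h4 2
      nlinarith
    have h := hanti (left_mem_Icc.2 hs₁₃) (right_mem_Icc.2 hs₁₃) hs₁₃
    simp only [Pi.add_apply] at h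
    have h6 : ζ s₁ ≤ 2 * ε := hζ s₁ ⟨le_rfl, hs₁₃.trans hs₃⟩
    have h7 : 0 < ζ s₃ := hcon s₃ (right_mem_Icc.2 hs₁₃)
    linarith
  obtain ⟨t, ht, hζt⟩ := hexists
  -- Step 2: from `t` on, `ζ ≤ 0` (at `ζ = 0`, `ζ′ ≤ −q ≤ −k² < 0`)
  have htT : t ≤ T := ht.2.trans hs₃
  have hsubt : Icc t T ⊆ Icc s₁ T := Icc_subset_Icc_left ht.1
  have key := image_le_of_deriv_right_lt_deriv_boundary (f := ζ) (a := t) (b := T)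
    (f' := fun x ↦ ζ x ^ 2 - q x - (‖u' x‖ ^ 2 / ‖u x‖ ^ 2 - ζ x ^ 2))
    (fun x hx ↦ (hder x (hsubt hx)).1.continuousAt.continuousWithinAt)
    (fun x hx ↦ (hder x (hsubt (Ico_subset_Icc_self hx))).1.hasDerivWithinAt)
    (B := fun _ ↦ 0) (B' := fun _ ↦ 0) hζt (fun x ↦ hasDerivAt_const x _)
    (fun x hx hxB ↦ by
      have hx' : x ∈ Icc s₁ T := hsubt (Ico_subset_Icc_self hx)
      have hD := (hder x hx').2
      have hq0 := hqk x hx'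
      show ζ x ^ 2 - q x - (‖u' x‖ ^ 2 / ‖u x‖ ^ 2 - ζ x ^ 2) < 0
      have hζx : ζ x = 0 := hxB
      rw [hζx]; nlinarith)
  intro x hx
  have h1 : ζ x ≤ 0 := key ⟨ht.2.trans hx.1, hx.2⟩
  have hpos : 0 < ‖u x‖ ^ 2 := by
    have := hne x (hsub ⟨ht.1.trans (ht.2.trans hx.1), hx.2⟩); positivity
  have h2 : -(conj (u x) * u' x).re / ‖u x‖ ^ 2 ≤ 0 := h1
  have h3 := (div_le_iff₀ hpos).1 h2
  linarith

/-! ### Quasi-monotonicity of `|u|` -/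

/-- **Quasi-monotone growth.** If `ζ ≤ 2ε` on `[b, T]` (`ε ≥ 0`) and `Re(ū u′) ≥ 0` on `[s₃, T]`
(`b ≤ s₃`), then `|u(x)| ≤ e^{2ε(s₃ − b)}·|u(y)|` whenever `b ≤ x ≤ y ≤ T` and `s₃ ≤ y`
(`(|u|²e^{4εs})′ ≥ 0` on `[b, T]`; `|u|` non-decreasing on `[s₃, T]`). [folklore] -/
theorem norm_le_exp_mul_norm_of_negRate
    (hu : ∀ x ∈ Icc b T, HasDerivAt u (u' x) x ∧ HasDerivAt u' ((q x : ℂ) * u x) x)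
    {ε s₃ : ℝ} (hε : 0 ≤ ε) (hbs₃ : b ≤ s₃)
    (hζ : ∀ x ∈ Icc b T, -(2 * ε) * ‖u x‖ ^ 2 ≤ (conj (u x) * u' x).re)
    (hpos : ∀ x ∈ Icc s₃ T, 0 ≤ (conj (u x) * u' x).re)
    {x y : ℝ} (hbx : b ≤ x) (hxy : x ≤ y) (hyT : y ≤ T) (hs₃y : s₃ ≤ y) :
    ‖u x‖ ≤ Real.exp (2 * ε * (s₃ - b)) * ‖u y‖ := by
  -- `F(s) = |u s|² e^{4εs}` is non-decreasing on `[b, T]`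
  set F : ℝ → ℝ := fun s ↦ ‖u s‖ ^ 2 * Real.exp (4 * ε * s) with hF
  have hFder : ∀ s ∈ Icc b T, HasDerivAt F (2 * (conj (u s) * u' s).re * Real.exp (4 * ε * s) +
      ‖u s‖ ^ 2 * (4 * ε * Real.exp (4 * ε * s))) s := by
    intro s hs
    have h1 := hasDerivAt_norm_sq_complex (hu s hs).1
    have h2 : HasDerivAt (fun s ↦ Real.exp (4 * ε * s)) (4 * ε * Real.exp (4 * ε * s)) s := by
      have := ((hasDerivAt_id s).const_mul (4 * ε)).exp
      simpa [mul_comm] using this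
    exact h1.mul h2
  have hFmono : MonotoneOn F (Icc b T) := by
    refine monotoneOn_of_deriv_nonneg (convex_Icc b T)
      (fun s hs ↦ (hFder s hs).continuousAt.continuousWithinAt)
      (fun s hs ↦ (hFder s (interior_subset hs)).differentiableAt.differentiableWithinAt) ?_
    intro s hs
    have hs' : s ∈ Icc b T := interior_subset hs
    rw [(hFder s hs').deriv]
    have he : 0 < Real.exp (4 * ε * s) := Real.exp_pos _
    have h := hζ s hs'
    nlinarith [h, he, sq_nonneg ‖u s‖]
  -- `|u|` is non-decreasing on `[s₃, T]`
  have hmono : MonotoneOn (fun s ↦ ‖u s‖ ^ 2) (Icc s₃ T) := by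
    refine monotoneOn_of_deriv_nonneg (convex_Icc s₃ T)
      (fun s hs ↦ (hasDerivAt_norm_sq_complex (hu s ⟨hbs₃.trans hs.1, hs.2⟩).1).continuousAt.continuousWithinAt)
      (fun s hs ↦ (hasDerivAt_norm_sq_complex
        (hu s ⟨hbs₃.trans (interior_subset hs).1, (interior_subset hs).2⟩).1).differentiableAt.differentiableWithinAt)
      ?_
    intro s hs
    have hs' : s ∈ Icc s₃ T := interior_subset hs
    rw [(hasDerivAt_norm_sq_complex (hu s ⟨hbs₃.trans hs'.1, hs'.2⟩).1).deriv]
    have := hpos s hs'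
    positivity
  -- compare through the point `z = max x s₃ ∈ [s₃, y]`
  set z := max x s₃ with hz
  have hxz : x ≤ z := le_max_left _ _
  have hs₃z : s₃ ≤ z := le_max_right _ _
  have hzy : z ≤ y := max_le hxy hs₃y
  have hzT : z ≤ T := hzy.trans hyT
  -- `|u x|² e^{4εx} ≤ |u z|² e^{4εz}` and `|u z|² ≤ |u y|²`
  have h1 : F x ≤ F z := hFmono ⟨hbx, hxz.trans hzT⟩ ⟨hbx.trans hxz, hzT⟩ hxz
  have h2 : ‖u z‖ ^ 2 ≤ ‖u y‖ ^ 2 := hmono ⟨hs₃z, hzT⟩ ⟨hs₃y, hyT⟩ hzy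
  simp only [hF] at h1
  -- `e^{4ε(z − x)} ≤ e^{4ε(s₃ − b)}`… no: `z − x ≤ s₃ − b`? we have `z − x ≤ z − b` and `z ≤ ?`; use
  -- instead `z − x ≤ s₃ − b` when `z = s₃` (`x ≤ s₃`), and `z − x = 0` when `z = x`.
  have hzx : z - x ≤ s₃ - b := by
    rcases le_total x s₃ with h | h
    · rw [hz, max_eq_right h]; linarith
    · rw [hz, max_eq_left h]; linarith
  have hexp : Real.exp (4 * ε * x) * Real.exp (4 * ε * (s₃ - b)) ≥ Real.exp (4 * ε * z) := by
    rw [← Real.exp_add, ge_iff_le, Real.exp_le_exp]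
    nlinarith
  have hsq : ‖u x‖ ^ 2 ≤ Real.exp (4 * ε * (s₃ - b)) * ‖u y‖ ^ 2 := by
    have hex : 0 < Real.exp (4 * ε * x) := Real.exp_pos _
    have hez : 0 < Real.exp (4 * ε * z) := Real.exp_pos _
    -- `|u x|² e^{4εx} ≤ |u y|² e^{4εz} ≤ |u y|² e^{4εx} e^{4ε(s₃−b)}`
    have h3 : ‖u x‖ ^ 2 * Real.exp (4 * ε * x) ≤ ‖u y‖ ^ 2 * (Real.exp (4 * ε * x) *
        Real.exp (4 * ε * (s₃ - b))) := by
      calc ‖u x‖ ^ 2 * Real.exp (4 * ε * x) ≤ ‖u z‖ ^ 2 * Real.exp (4 * ε * z) := h1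
        _ ≤ ‖u y‖ ^ 2 * Real.exp (4 * ε * z) := mul_le_mul_of_nonneg_right h2 hez.le
        _ ≤ ‖u y‖ ^ 2 * (Real.exp (4 * ε * x) * Real.exp (4 * ε * (s₃ - b))) :=
            mul_le_mul_of_nonneg_left hexp (sq_nonneg _)
    have h4 : ‖u x‖ ^ 2 * Real.exp (4 * ε * x) ≤
        (Real.exp (4 * ε * (s₃ - b)) * ‖u y‖ ^ 2) * Real.exp (4 * ε * x) := by
      calc _ ≤ _ := h3
        _ = (Real.exp (4 * ε * (s₃ - b)) * ‖u y‖ ^ 2) * Real.exp (4 * ε * x) := by ring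
    exact le_of_mul_le_mul_right h4 hex
  -- take square roots
  have he2 : Real.exp (4 * ε * (s₃ - b)) = Real.exp (2 * ε * (s₃ - b)) ^ 2 := by
    rw [← Real.exp_nat_mul]; congr 1; push_cast; ring
  rw [he2, ← mul_pow] at hsq
  exact (pow_le_pow_iff_left₀ (norm_nonneg _) (by positivity) two_ne_zero).1 hsq

end QuasiMonotone

end Literature.Analysis.ODE

end
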